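import Mathlib
import Summits.ValiantsHypothesis.ValiantsHypothesis.Theorems.GrenetZeonTwoDimCoefficientsDefs
import Summits.ValiantsHypothesis.ValiantsHypothesis.Theorems.GrenetZeonTwoDimCoefficientsUnitReducedRescale
import Summits.ValiantsHypothesis.ValiantsHypothesis.Theorems.GrenetZeonTwoDimCoefficientsDualUnipotentNormalForm

/-!
# Crux `GrenetZeon.TwoDimCoefficients` (stmt-ValiantsHypothesis-8062), stub `stub_dualUnipotent`:
# the nilpotent-pencil normal form carries the TRACE CONSTRAINTS `tr(N^j M) = 0` (`j ≠ n − 1`)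

Refinement of the normal form N4 of `…DualUnipotentNormalForm.lean` (val-width-8062-p1,
`exists_nilpotent_pencil_of_dualUnipotentRepr`: `per_n = tr(N^{n−1}·M)`, `N`, `M` linear, `N^m = 0`).
The same comparison of homogeneous components, done in EVERY degree and not only in degree `n`,
shows that the pair `(N, M)` produced there satisfies in addition

  `tr(N^j · M) = 0` for every `j ≠ n − 1`

(`exists_constrained_pencil_of_dualUnipotentRepr`): the degree-`(j+1)` component of
`α·det A + β·tr(adj A·B) = per_n` is `tr(N^j·M)` on the left and `0` on the right unless
`j + 1 = n`.  These constraints are exactly what distinguishes the ACTUAL unipotent trace model from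
the bare normal form "`tr(N^{n−1}M)`, `N` a nilpotent linear pencil": a pair `(N, M)` with the
constraints is realised at the same width (`B(0) = 0`, `B = M`), one without them is not (closed
walks of the other lengths do not cancel).  Why it matters (memo
`Cruxes/TwoDimCoefficients/PROFILE-BARRIER-stub_dualUnipotent.md`, v4): numerically the bare
normal form carries the permanent's full Hessian profile already at LINEAR width (complete DAGs),
whereas under the trace constraints every sampled element has Hessian rank `≤ m²/n` at every point
— the block-chain value, attained (`…TraceChainProfile.lean`); the conjectured bound
`rank Hess ≤ C·m²/n` under the constraints would give the first superlinear bound `m ≳ n^{3/2}`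
for the stub's model.  This file only types the constraints.

HONEST FRAMING: bookkeeping; the stub stays open; `VP ≠ VNP` is not moved.

References: L. G. Valiant, STOC 1979, §2; T. Mignon, N. Ressayre, Int. Math. Res. Not. 2004:79.
-/

-- single-conjunct layout `Summits/ValiantsHypothesis/ValiantsHypothesis`: the duplicated namespace
-- component is mandated by the tree.
set_option linter.dupNamespace false

noncomputable section

namespace Summit.ValiantsHypothesis.ValiantsHypothesis.Cruxes.TwoDimCoefficients.DimTwoCases

open Literature.Computability.AlgebraicComplexity Matrix MvPolynomial

variable {n m : ℕ}

/-- **Normal form with trace constraints.**  A unipotent dual representation of `per_n` of size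
`m` (`n ≥ 1`) yields matrices `N`, `M` of linear forms with `N^m = 0`, `per_n = tr(N^{n−1}·M)`, AND
`tr(N^j·M) = 0` for every `j ≠ n − 1` (comparison of homogeneous components in every degree).
[folklore] -/
theorem exists_constrained_pencil_of_dualUnipotentRepr (hn : 1 ≤ n) (h : DualUnipotentRepr n m) :
    ∃ N M : AffMat n m, (∀ i j, (N i j).IsHomogeneous 1) ∧ (∀ i j, (M i j).IsHomogeneous 1) ∧
      N ^ m = 0 ∧ perPoly (Fin n) ℂ = (N ^ (n - 1) * M).trace ∧
      ∀ j : ℕ, j ≠ n - 1 → (N ^ j * M).trace = 0 := by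
  obtain ⟨α, β, c, A, B, hA, hB, hc, hdet, hper⟩ := h
  obtain ⟨k, rfl⟩ : ∃ k, n = k + 1 := ⟨n - 1, by omega⟩
  simp only [Nat.add_sub_cancel]
  -- constant parts
  set A₀ : Matrix (Fin m) (Fin m) ℂ := A.map constantCoeff with hA₀
  set B₀ : Matrix (Fin m) (Fin m) ℂ := B.map constantCoeff with hB₀
  have hA₀det : A₀.det = c := by
    have h := RingHom.map_det (constantCoeff : MvPolynomial (Fin (k + 1) × Fin (k + 1)) ℂ →+* ℂ) A
    rw [hdet, constantCoeff_C, RingHom.mapMatrix_apply] at h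
    exact h.symm
  have hA₀u : IsUnit A₀.det := by rw [hA₀det]; exact isUnit_iff_ne_zero.2 hc
  set G : Matrix (Fin m) (Fin m) ℂ := A₀⁻¹ with hG
  have hGA : G * A₀ = 1 := Matrix.nonsing_inv_mul A₀ hA₀u
  have hAG : A₀ * G = 1 := Matrix.mul_nonsing_inv A₀ hA₀u
  -- lifts to polynomial matrices
  set A₀C : AffMat (k + 1) m := A₀.map MvPolynomial.C with hA₀C
  set B₀C : AffMat (k + 1) m := B₀.map MvPolynomial.C with hB₀C
  set GC : AffMat (k + 1) m := G.map MvPolynomial.C with hGC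
  have hGAC : GC * A₀C = 1 := by
    rw [hGC, hA₀C, ← RingHom.mapMatrix_apply, ← RingHom.mapMatrix_apply, ← map_mul, hGA, map_one]
  have hAGC : A₀C * GC = 1 := by
    rw [hGC, hA₀C, ← RingHom.mapMatrix_apply, ← RingHom.mapMatrix_apply, ← map_mul, hAG, map_one]
  -- linear parts
  set A₁ : AffMat (k + 1) m := A - A₀C with hA₁
  set B₁ : AffMat (k + 1) m := B - B₀C with hB₁
  have hA₁h : ∀ i j, (A₁ i j).IsHomogeneous 1 := by
    intro i j
    rw [hA₁, Matrix.sub_apply, hA₀C, Matrix.map_apply, hA₀, Matrix.map_apply, constantCoeff_eq]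
    exact isHomogeneous_one_sub_C_coeff_zero _ (hA i j)
  have hB₁h : ∀ i j, (B₁ i j).IsHomogeneous 1 := by
    intro i j
    rw [hB₁, Matrix.sub_apply, hB₀C, Matrix.map_apply, hB₀, Matrix.map_apply, constantCoeff_eq]
    exact isHomogeneous_one_sub_C_coeff_zero _ (hB i j)
  -- the pencil
  set N : AffMat (k + 1) m := -(GC * A₁) with hN
  have hNh : ∀ i j, (N i j).IsHomogeneous 1 := by
    intro i j
    rw [hN, Matrix.neg_apply]
    refine IsHomogeneous.neg ?_
    have := isHomogeneous_mul_apply (isHomogeneous_map_C_apply G) hA₁h i j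
    rwa [zero_add] at this
  have hAfac : A = A₀C * (1 - N) := by
    rw [hN, sub_neg_eq_add, Matrix.mul_add, Matrix.mul_one, ← Matrix.mul_assoc, hAGC,
      Matrix.one_mul, hA₁, add_sub_cancel]
  have hdet1 : (1 - N).det = 1 := by
    have h1 : A.det = MvPolynomial.C c * (1 - N).det := by
      rw [hAfac, Matrix.det_mul, hA₀C, ← RingHom.mapMatrix_apply, ← RingHom.map_det, hA₀det]
    have hCc : (MvPolynomial.C c : MvPolynomial (Fin (k + 1) × Fin (k + 1)) ℂ) ≠ 0 := by
      rwa [Ne, C_eq_zero]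
    apply mul_left_cancel₀ hCc
    rw [← h1, hdet, mul_one]
  have hNm : N ^ m = 0 := pow_eq_zero_of_isHomogeneous_one N hNh hdet1
  -- the inverse and the adjugate of `A`
  set S : AffMat (k + 1) m := ∑ i ∈ Finset.range m, N ^ i with hS
  have hNS : (1 - N) * S = 1 := by rw [hS, mul_neg_geom_sum, hNm, sub_zero]
  have hAinv : A⁻¹ = S * GC := by
    apply Matrix.inv_eq_right_inv
    rw [hAfac, Matrix.mul_assoc, ← Matrix.mul_assoc (1 - N), hNS, Matrix.one_mul, hAGC]
  have hAu : IsUnit A.det := by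
    rw [hdet]; exact (isUnit_iff_ne_zero.2 hc).map MvPolynomial.C
  have hadj : A.adjugate = (MvPolynomial.C c : MvPolynomial (Fin (k + 1) × Fin (k + 1)) ℂ) • (S * GC) := by
    rw [adjugate_eq_det_smul_inv A hAu, hdet, hAinv]
  -- the trace, term by term
  have hBdec : B = B₀C + B₁ := by rw [hB₁, add_sub_cancel]
  have htr : (A.adjugate * B).trace = MvPolynomial.C c *
      ∑ i ∈ Finset.range m, ((N ^ i * GC * B₀C).trace + (N ^ i * GC * B₁).trace) := by
    rw [hadj, Matrix.smul_mul, Matrix.trace_smul, smul_eq_mul, hS, Finset.sum_mul,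
      Finset.sum_mul, Matrix.trace_sum]
    congr 1
    refine Finset.sum_congr rfl fun i _ => ?_
    rw [← Matrix.trace_add, ← Matrix.mul_add, ← hBdec]
  -- degrees of the terms
  have hT : ∀ i, ((N ^ i * GC * B₀C).trace).IsHomogeneous i := by
    intro i
    refine isHomogeneous_trace fun a b => ?_
    have h1 := isHomogeneous_mul_apply (isHomogeneous_pow_apply hNh i) (isHomogeneous_map_C_apply G)
    have h2 := isHomogeneous_mul_apply h1 (isHomogeneous_map_C_apply B₀) a b
    simpa using h2
  have hT' : ∀ i, ((N ^ i * GC * B₁).trace).IsHomogeneous (i + 1) := by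
    intro i
    refine isHomogeneous_trace fun a b => ?_
    have h1 := isHomogeneous_mul_apply (isHomogeneous_pow_apply hNh i) (isHomogeneous_map_C_apply G)
    have h2 := isHomogeneous_mul_apply h1 hB₁h a b
    simpa using h2
  -- the matrix `M`
  set M : AffMat (k + 1) m :=
    (MvPolynomial.C (β * c) : MvPolynomial (Fin (k + 1) × Fin (k + 1)) ℂ) • (N * GC * B₀C + GC * B₁)
    with hM
  have hMh : ∀ i j, (M i j).IsHomogeneous 1 := by
    intro i j
    rw [hM, Matrix.smul_apply, smul_eq_mul]
    refine IsHomogeneous.C_mul ?_ _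
    rw [Matrix.add_apply]
    refine IsHomogeneous.add ?_ ?_
    · have h1 := isHomogeneous_mul_apply hNh (isHomogeneous_map_C_apply G)
      have h2 := isHomogeneous_mul_apply h1 (isHomogeneous_map_C_apply B₀) i j
      simpa using h2
    · have h2 := isHomogeneous_mul_apply (isHomogeneous_map_C_apply G) hB₁h i j
      simpa using h2
  have hNjM : ∀ j, (N ^ j * M).trace =
      MvPolynomial.C (β * c) * ((N ^ (j + 1) * GC * B₀C).trace + (N ^ j * GC * B₁).trace) := by
    intro j
    rw [hM, Matrix.mul_smul, Matrix.trace_smul, smul_eq_mul, Matrix.mul_add, Matrix.trace_add,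
      pow_succ, Matrix.mul_assoc, Matrix.mul_assoc, Matrix.mul_assoc, Matrix.mul_assoc]
  -- KEY: every homogeneous component of the representation identity
  have hkey : ∀ j, j < m → (N ^ j * M).trace = homogeneousComponent (j + 1) (perPoly (Fin (k + 1)) ℂ) := by
    intro j hj
    -- extend the range so that the index `j + 1` is present
    set K : ℕ := m + 1 with hK
    have hext : ∑ i ∈ Finset.range m, ((N ^ i * GC * B₀C).trace + (N ^ i * GC * B₁).trace) =
        ∑ i ∈ Finset.range K, ((N ^ i * GC * B₀C).trace + (N ^ i * GC * B₁).trace) := by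
      refine Finset.sum_subset (Finset.range_subset_range.2 (by omega)) fun i hi hi' => ?_
      have hmi : m ≤ i := by
        rw [Finset.mem_range] at hi hi'
        omega
      have hNi : N ^ i = 0 := by
        rw [← Nat.sub_add_cancel hmi, pow_add, hNm, mul_zero]
      rw [hNi, Matrix.zero_mul, Matrix.zero_mul, Matrix.zero_mul, Matrix.trace_zero, add_zero]
    rw [hper, htr, hext, hdet, ← map_mul, map_add, homogeneousComponent_of_isHomogeneous
      (isHomogeneous_C _ (α * c)) (j + 1), if_neg (Nat.succ_ne_zero j), zero_add,
      homogeneousComponent_C_mul, homogeneousComponent_C_mul, map_sum, hNjM]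
    simp_rw [map_add, homogeneousComponent_of_isHomogeneous (hT _),
      homogeneousComponent_of_isHomogeneous (hT' _), Finset.sum_add_distrib, Finset.sum_ite_eq,
      Finset.mem_range]
    rw [if_pos (by omega), Finset.sum_eq_single j]
    · rw [if_pos rfl, map_mul, mul_assoc]
    · intro i _ hi
      rw [if_neg]
      omega
    · intro hj'
      exact absurd (Finset.mem_range.2 (by omega)) hj'
  have hperh : (perPoly (Fin (k + 1)) ℂ).IsHomogeneous (k + 1) := by
    simpa [Fintype.card_fin] using perPoly_isHomogeneous (n := Fin (k + 1)) (k := ℂ)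
  refine ⟨N, M, hNh, hMh, hNm, ?_, ?_⟩
  · -- degree `k + 1`: the normal form (needs `k < m`; otherwise `per = 0`-type degenerate case)
    by_cases hkm : k < m
    · rw [hkey k hkm, homogeneousComponent_of_isHomogeneous hperh, if_pos rfl]
    · -- `m ≤ k`: then `N ^ k = 0` and every component of the right-hand side of degree `k+1`
      -- vanishes, so `per_{k+1} = 0`-component: derive from `hkey`-style computation at large range
      exfalso
      -- the degree-`(k+1)` component of the representation is zero while that of `per` is `per ≠ 0`
      have hNk : N ^ k = 0 := pow_eq_zero_of_le (not_lt.mp hkm) hNm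
      have hNk1 : N ^ (k + 1) = 0 := by rw [pow_succ, hNk, Matrix.zero_mul]
      have hcomp := congrArg (homogeneousComponent (k + 1)) hper
      rw [homogeneousComponent_of_isHomogeneous hperh, if_pos rfl, htr, hdet, ← map_mul, map_add,
        homogeneousComponent_of_isHomogeneous (isHomogeneous_C _ (α * c)) (k + 1),
        if_neg (Nat.succ_ne_zero k), zero_add, homogeneousComponent_C_mul, homogeneousComponent_C_mul,
        map_sum] at hcomp
      simp_rw [map_add, homogeneousComponent_of_isHomogeneous (hT _),
        homogeneousComponent_of_isHomogeneous (hT' _), Finset.sum_add_distrib, Finset.sum_ite_eq,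
        Finset.mem_range] at hcomp
      rw [if_neg (by omega), zero_add, Finset.sum_eq_zero] at hcomp
      · have hne : perPoly (Fin (k + 1)) ℂ ≠ 0 := by
          intro h0
          -- evaluation at the identity matrix: per(1) = 1
          have h1 : eval (fun p : Fin (k + 1) × Fin (k + 1) => if p.1 = p.2 then (1 : ℂ) else 0)
              (perPoly (Fin (k + 1)) ℂ) = 1 := by
            rw [eval_perPoly]
            have : (Matrix.of fun i j : Fin (k + 1) => if ((i, j) : Fin (k + 1) × Fin (k + 1)).1 =
                ((i, j) : Fin (k + 1) × Fin (k + 1)).2 then (1 : ℂ) else 0) = 1 := by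
              ext i j; simp [Matrix.one_apply]
            rw [this, Matrix.permanent_one]
          rw [h0, map_zero] at h1
          exact zero_ne_one h1
        rw [mul_zero, mul_zero] at hcomp
        exact hne hcomp
      · intro i hi
        rw [Finset.mem_range] at hi
        by_cases hik : k + 1 = i + 1
        · have hi' : i = k := by omega
          subst hi'
          rw [if_pos rfl, hNk, Matrix.zero_mul, Matrix.zero_mul, Matrix.trace_zero]
        · rw [if_neg hik]
  · intro j hj
    by_cases hjm : j < m
    · rw [hkey j hjm, homogeneousComponent_of_isHomogeneous hperh, if_neg (by omega)]
    · rw [pow_eq_zero_of_le (not_lt.mp hjm) hNm, Matrix.zero_mul, Matrix.trace_zero]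

end Summit.ValiantsHypothesis.ValiantsHypothesis.Cruxes.TwoDimCoefficients.DimTwoCases

end
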